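import Mathlib.Analysis.InnerProductSpace.PiL2
import Literature.MathematicalPhysics.StatisticalMechanics.BarlowStacking
import Literature.MathematicalPhysics.StatisticalMechanics.LocalMatchingCompactness
import Literature.MathematicalPhysics.StatisticalMechanics.LocalLimitOfGroundStates

/-!
# Sketch — crux-ideate stmt-AtomisticToContinuum-13961 (`PhononSlackCertificates.HullBridge`), ideator 1

First lemmas of the two idea cards (statements only; `sorry` bodies), checked to elaborate.

* `oneLimit_exactLayerTheorem` — card `one-limit-exact-stacking`: an infinite point set of `ℝ³`
  that is EXACTLY layered (box format of `LayeredWindows`, tolerance `0`) on every open `2`-ball is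
  globally one layered set (relaxed-spacing form of Hales, *Dense Sphere Packings* §1.3, tree
  `LayerStackings.lean`).
* `oneLimit_pullback` — the pull-back step of the same card: a local limit `Y` of recentred ground
  states that is globally a layered set hands `LayeredWindows`-windows to the sequence, with the
  in-layer spacing `a` READ OFF `Y`.
* `finiteMargin_exactWindowLemma` — card `finite-exact-window-sqrt3-margin`: the finite exact
  local-to-global lemma with margin radius `3R + 10` (any factor `> √3` is the bet).
* `junction_bound` — the elementary junction inequality behind the margin `√3`.
-/

namespace Summit.AtomisticToContinuum.Crystallization.Cruxes.HullBridge.SketchIdeator1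

open Literature.MathematicalPhysics.StatisticalMechanics
open scoped RealInnerProductSpace

local notation "E3" => EuclideanSpace ℝ (Fin 3)

/-- FIRST LEMMA of card `one-limit-exact-stacking` (infinite exact layer theorem, relaxed spacings):
a non-empty `Y ⊆ ℝ³` every point of which is exactly two-way matched on its open `2`-ball with a
layered set of the `LayeredWindows` box (`a ∈ [47/50,1]`, Hägg word, interlayer spacings in
`[39a/50, 17a/20]`) is, after one translation, EQUAL to one such layered set. -/
theorem oneLimit_exactLayerTheorem (Y : Set E3) (hY : Y.Nonempty)
    (hloc : ∀ y ∈ Y, ∃ (A : E3 →ₗᵢ[ℝ] E3) (t : E3) (a : ℝ) (s : ℤ → ℤ) (z : ℤ → ℝ),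
      47 / 50 ≤ a ∧ a ≤ 1 ∧ IsHaggSeq s ∧
      (∀ m : ℤ, 39 / 50 * a ≤ z (m + 1) - z m ∧ z (m + 1) - z m ≤ 17 / 20 * a) ∧
      let S : Set E3 := {p | ∃ m i j : ℤ, p = A (((i : ℝ) • triangularVec₁ a) +
        ((j : ℝ) • triangularVec₂ a) + ((haggLabel s m : ℝ) • barlowOffset a) +
        (z m • layerNormal 1))};
      (∀ y' ∈ Y, dist y' y < 2 → y' + t ∈ S) ∧ (∀ p ∈ S, dist p (y + t) < 2 → ∃ y' ∈ Y, y' + t = p)) :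
    ∃ (A : E3 →ₗᵢ[ℝ] E3) (t : E3) (a : ℝ) (s : ℤ → ℤ) (z : ℤ → ℝ),
      47 / 50 ≤ a ∧ a ≤ 1 ∧ IsHaggSeq s ∧
      (∀ m : ℤ, 39 / 50 * a ≤ z (m + 1) - z m ∧ z (m + 1) - z m ≤ 17 / 20 * a) ∧
      let S : Set E3 := {p | ∃ m i j : ℤ, p = A (((i : ℝ) • triangularVec₁ a) +
        ((j : ℝ) • triangularVec₂ a) + ((haggLabel s m : ℝ) • barlowOffset a) +
        (z m • layerNormal 1))};
      (fun y => y + t) '' Y = S := by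
  sorry

/-- PULL-BACK step of card `one-limit-exact-stacking`: if the recentred ground states
`{x^N_j − x^N_{c N}}` converge locally (tree `BallMatch`, along a subsequence `φ`) to a set `Y`
which is globally a layered set of the box, then the sequence has layered windows at every scale
with THE SAME in-layer spacing `a` (the `∃ a` of `LayeredWindows` is read off the limit). -/
theorem oneLimit_pullback (x : (N : ℕ) → (Fin N → E3)) (c : (N : ℕ) → Fin (N + 1))
    (φ : ℕ → ℕ) (hφ : StrictMono φ) (Y : Set E3)
    (hlim : ∀ R ε : ℝ, 0 < ε → ∀ᶠ k in Filter.atTop,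
      BallMatch ε R 0 (Set.range fun j : Fin (φ k + 1) => x (φ k + 1) j - x (φ k + 1) (c (φ k))) Y)
    (A : E3 →ₗᵢ[ℝ] E3) (t₀ : E3) (a : ℝ) (s : ℤ → ℤ) (z : ℤ → ℝ)
    (ha : 47 / 50 ≤ a ∧ a ≤ 1) (hs : IsHaggSeq s)
    (hz : ∀ m : ℤ, 39 / 50 * a ≤ z (m + 1) - z m ∧ z (m + 1) - z m ≤ 17 / 20 * a)
    (hYS : (fun y => y + t₀) '' Y = {p | ∃ m i j : ℤ, p = A (((i : ℝ) • triangularVec₁ a) +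
        ((j : ℝ) • triangularVec₂ a) + ((haggLabel s m : ℝ) • barlowOffset a) +
        (z m • layerNormal 1))}) :
    ∀ R ε : ℝ, 0 < ε → ∃ᶠ N in Filter.atTop, ∃ (A : E3 →ₗᵢ[ℝ] E3) (t : E3) (s : ℤ → ℤ) (z : ℤ → ℝ),
      IsHaggSeq s ∧ (∀ m : ℤ, 39 / 50 * a ≤ z (m + 1) - z m ∧ z (m + 1) - z m ≤ 17 / 20 * a) ∧
      let S : Set E3 := {p | ∃ m i j : ℤ, p = A (((i : ℝ) • triangularVec₁ a) +
        ((j : ℝ) • triangularVec₂ a) + ((haggLabel s m : ℝ) • barlowOffset a) +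
        (z m • layerNormal 1))};
      (∀ p ∈ S, ‖p‖ ≤ R → ∃ i : Fin N, dist (x N i + t) p ≤ ε) ∧
      (∀ i : Fin N, ‖x N i + t‖ ≤ R → ∃ p ∈ S, dist (x N i + t) p ≤ ε) := by
  sorry

/-- FIRST LEMMA of card `finite-exact-window-sqrt3-margin` (finite exact local-to-global with
margin): in a `1/3`-separated finite configuration, if every particle within `3R + 10` of `x i₀` is
exactly layered on its open `2`-ball, then the configuration is exactly two-way matched with ONE
layered set on the closed `R`-ball about `x i₀`.  (Any margin factor `> √3` is the bet; `< √3`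
is refuted by two non-parallel twin planes whose junction lies outside the margin ball.) -/
theorem finiteMargin_exactWindowLemma (R : ℝ) (hR : 0 ≤ R) {N : ℕ} (x : Fin N → E3)
    (hsep : ∀ i j : Fin N, i ≠ j → 1 / 3 ≤ dist (x i) (x j)) (i₀ : Fin N)
    (hloc : ∀ i : Fin N, dist (x i) (x i₀) ≤ 3 * R + 10 →
      ∃ (A : E3 →ₗᵢ[ℝ] E3) (t : E3) (a : ℝ) (s : ℤ → ℤ) (z : ℤ → ℝ),
      47 / 50 ≤ a ∧ a ≤ 1 ∧ IsHaggSeq s ∧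
      (∀ m : ℤ, 39 / 50 * a ≤ z (m + 1) - z m ∧ z (m + 1) - z m ≤ 17 / 20 * a) ∧
      let S : Set E3 := {p | ∃ m i j : ℤ, p = A (((i : ℝ) • triangularVec₁ a) +
        ((j : ℝ) • triangularVec₂ a) + ((haggLabel s m : ℝ) • barlowOffset a) +
        (z m • layerNormal 1))};
      (∀ j : Fin N, dist (x j) (x i) < 2 → x j + t ∈ S) ∧
      (∀ p ∈ S, dist p (x i + t) < 2 → ∃ j : Fin N, x j + t = p)) :
    ∃ (A : E3 →ₗᵢ[ℝ] E3) (t : E3) (a : ℝ) (s : ℤ → ℤ) (z : ℤ → ℝ),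
      47 / 50 ≤ a ∧ a ≤ 1 ∧ IsHaggSeq s ∧
      (∀ m : ℤ, 39 / 50 * a ≤ z (m + 1) - z m ∧ z (m + 1) - z m ≤ 17 / 20 * a) ∧
      let S : Set E3 := {p | ∃ m i j : ℤ, p = A (((i : ℝ) • triangularVec₁ a) +
        ((j : ℝ) • triangularVec₂ a) + ((haggLabel s m : ℝ) • barlowOffset a) +
        (z m • layerNormal 1))};
      (∀ j : Fin N, dist (x j) (x i₀) ≤ R → x j + t ∈ S) ∧
      (∀ p ∈ S, dist p (x i₀ + t) ≤ R → ∃ j : Fin N, x j + t = p) := by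
  sorry

/-- The junction inequality behind the margin: two planes with unit normals at the fcc twin
angle (`|⟪n₁, n₂⟫| ≤ 1/3`), both meeting the closed `R`-ball about `0`, intersect within distance
`√3 · R` of `0` (sharp for `⟪n₁,n₂⟫ = 1/3`, `d₁ = -d₂ = R`). Elementary linear algebra in
`span {n₁, n₂}`. -/
theorem junction_bound (n₁ n₂ : E3) (h₁ : ‖n₁‖ = 1) (h₂ : ‖n₂‖ = 1)
    (hang : abs (inner ℝ n₁ n₂) ≤ 1 / 3) (R d₁ d₂ : ℝ) (hd₁ : abs d₁ ≤ R) (hd₂ : abs d₂ ≤ R) :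
    ∃ x : E3, inner ℝ x n₁ = d₁ ∧ inner ℝ x n₂ = d₂ ∧ ‖x‖ ≤ Real.sqrt 3 * R := by
  sorry

end Summit.AtomisticToContinuum.Crystallization.Cruxes.HullBridge.SketchIdeator1
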